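import Literature.AlgebraicGeometry.Motives.JacobianThetaDivisorUniq
import Literature.AlgebraicGeometry.Motives.JacobianRiemannThetaTransport
import HarnessLib

/-!
# The canonical theta pairing of a complex Jacobian is transported along isomorphisms of curves and is
# Aut-invariant — UNCONDITIONALLY (the `Δ = 1` content of (F-P2), now fact-free)

Layer `Literature/AlgebraicGeometry/Motives`, namespace `Literature.AlgebraicGeometry.Motives.Jacobian`.  KERNEL ONLY: theorems;
no definition, no named fact, no instance, no `sorry`.

★ `Motives/JacobianThetaPairingOfCurveIso` proved, UNDER the named fact `(hFP2 : galoisCover_pullback_isWeilPairingAdjoint_norm)`,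
that the canonical theta pairings of the Jacobians of isomorphic smooth projective complex curves match along `Nm_e` and do not
depend on the theta divisor.  The (Θ-uniq) chain is now in the tree WITHOUT `hFP2` (★ `Jacobian.weilPairingLevel_eq_of_isRiemannThetaDivisor'`,
`Motives/JacobianThetaDivisorUniq`, route G3), and principal Riemann theta divisors pull back along `Nm_e` (★
`IsRiemannThetaDivisor.pullback_of_iso`, ★ `IsPrincipalPolarizationDivisor.pullback_of_isIso`); hence the same statements hold
fact-free ([Lange2023AbelianVarietiesComplex] §4.1.2 Prop. 4.1.2, §4.2.1 Cor. 4.2.4, §4.5.2 (4.9) at an isomorphism;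
[Milne1986JacobianVarieties] §6 Prop. 6.4, Rem. 6.5):

* `weilPairingLevel_pushforward_iso_eq'` — `ē_N^{Θ_Y}(Nm_e P, Nm_e Q) = ē_N^{Θ_X}(P, Q)` for `e : X ≅ Y`;
* `weilPairingLevel_pushforward_aut_eq` — (D): `ē_N^{Θ}(Nm_e P, Nm_e Q) = ē_N^{Θ}(P, Q)` for `e ∈ Aut X`;
* `weilPairingLevel_pushforward_inv_eq'` — adjoint form `ē_N^{Θ_X}(Nm_{e⁻¹} P, Q) = ē_N^{Θ_Y}(P, Nm_e Q)`;
* `weilPairingLevel_uniqueUpToIso_eq'` — two Jacobian structures of one curve.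

Use (cell `hodgecm-mathlib`, D-0151; crux HLiu418 = stmt-HodgeConjecture-24832, `stub_RosH` road (P), piece (L) «level adjoints of
isomorphisms between pieces»): consumers of the `hFP2`-versions may drop the fact for these letters; (F-P2) itself stays needed only for
GENUINE covers, where it is kernel-equivalent to (C) (★ `galoisCover_pullback_isWeilPairingAdjoint_norm_iff_pullbackPow`).  COUNT-NEUTRAL.
HC_CM is proved only modulo the 7 printed citations until rung 0 closes; this file moves no book by itself.

## References
* [Lange2023AbelianVarietiesComplex] H. Lange, *Abelian Varieties over the Complex Numbers* (2023), §4.1.2 Prop. 4.1.2, §4.2.1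
  Cor. 4.2.4, §4.5.2 eq. (4.9).
* [Milne1986JacobianVarieties] J. S. Milne, *Jacobian Varieties*, in Cornell–Silverman (1986), §6 Prop. 6.4, Remark 6.5, Thm. 6.6.
* [MumfordAV1970] D. Mumford, *Abelian Varieties* (1970), §20 property (3) of `e_n` (p. 186).
-/

set_option autoImplicit false

noncomputable section

open CategoryTheory AlgebraicGeometry

namespace Literature.AlgebraicGeometry.Motives

namespace Jacobian

variable {X Y : SchemeOver ℂ}

/-- **`ē_N^{Θ_Y}(Nm_e P, Nm_e Q) = ē_N^{Θ_X}(P, Q)`, fact-free**: for an isomorphism `e : X ≅ Y` of smooth projective complex curves,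
Jacobians `𝒥X`, `𝒥Y` with `dim J_Y ≥ 1`, and ANY principal Riemann theta divisors `Θ_X`, `Θ_Y`, the isomorphism `Nm_e : J_X ⥲ J_Y`
matches the canonical theta pairings at every level (`ē^{Θ_Y}(Nm_e P, Nm_e Q) = ē^{(Nm_e)^*Θ_Y}(P, Q)` and (Θ-uniq) on `J_X`).
[cite: Lange2023AbelianVarietiesComplex, §4.5.2 eq. (4.9) and §4.1.2 Prop. 4.1.2] [cite: Milne1986JacobianVarieties, §6 Prop. 6.4 and Remark 6.5] -/
theorem weilPairingLevel_pushforward_iso_eq' (hX : IsSmoothProjective 1 X)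
    (𝒥X : Jacobian X) (𝒥Y : Jacobian Y) (hdim : 1 ≤ 𝒥Y.J.dim) (e : X ≅ Y)
    {ΘX : CartierDivisor 𝒥X.J.X.left} {ΘY : CartierDivisor 𝒥Y.J.X.left}
    (h1 : 𝒥X.IsRiemannThetaDivisor ΘX) (h2 : 𝒥X.J.IsPrincipalPolarizationDivisor ΘX)
    (h3 : 𝒥Y.IsRiemannThetaDivisor ΘY) (h4 : 𝒥Y.J.IsPrincipalPolarizationDivisor ΘY)
    (N : ℕ) [IsDominant (AbelianVariety.Hom.toSchemeHom ((N : ℤ) • 𝟙 𝒥X.J))]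
    [IsDominant (AbelianVariety.Hom.toSchemeHom ((N : ℤ) • 𝟙 𝒥Y.J))]
    (P Q : 𝒥X.J.torsionPoints ℂ N) :
    𝒥Y.J.weilPairingLevel ΘY
        ⟨AlgPoints.map (𝒥X.pushforward 𝒥Y e.hom).hom.hom.hom P.1,
          AbelianVariety.map_mem_torsionPoints (𝒥X.pushforward 𝒥Y e.hom) P.2⟩
        ⟨AlgPoints.map (𝒥X.pushforward 𝒥Y e.hom).hom.hom.hom Q.1,
          AbelianVariety.map_mem_torsionPoints (𝒥X.pushforward 𝒥Y e.hom) Q.2⟩ =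
      𝒥X.J.weilPairingLevel ΘX P Q := by
  have huv : 𝒥X.pushforward 𝒥Y e.hom ≫ 𝒥Y.pushforward 𝒥X e.inv = 𝟙 _ := by
    rw [← pushforward_comp, e.hom_inv_id, pushforward_id]
  have hvu : 𝒥Y.pushforward 𝒥X e.inv ≫ 𝒥X.pushforward 𝒥Y e.hom = 𝟙 _ := by
    rw [← pushforward_comp, e.inv_hom_id, pushforward_id]
  haveI : IsIso (𝒥X.pushforward 𝒥Y e.hom) := ⟨_, huv, hvu⟩
  haveI : IsDominant (AbelianVariety.Hom.toSchemeHom (𝒥X.pushforward 𝒥Y e.hom)) := by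
    haveI := AbelianVariety.isIso_toSchemeHom_of_isIso (𝒥X.pushforward 𝒥Y e.hom)
    infer_instance
  have hdimX : 1 ≤ 𝒥X.J.dim := by rw [dim_eq_of_iso 𝒥X 𝒥Y e]; exact hdim
  rw [← AbelianVariety.weilPairingLevel_pullback (𝒥X.pushforward 𝒥Y e.hom) ΘY P Q]
  exact weilPairingLevel_eq_of_isRiemannThetaDivisor' hX 𝒥X hdimX (IsRiemannThetaDivisor.pullback_of_iso 𝒥X 𝒥Y e h3)
    (AbelianVariety.IsPrincipalPolarizationDivisor.pullback_of_isIso _ h4) h1 h2 N P Q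

/-- **(D), fact-free: automorphisms of a curve are isometries of the canonical theta pairing** —
`ē_N^{Θ}(Nm_e P, Nm_e Q) = ē_N^{Θ}(P, Q)` for `e : X ≅ X`, a Jacobian `𝒥` with `dim J ≥ 1` and a principal Riemann theta divisor
`Θ` ([Lange2023AbelianVarietiesComplex] Prop. 4.1.2: the canonical polarisation is intrinsic).
[cite: Lange2023AbelianVarietiesComplex, §4.1.2 Prop. 4.1.2 and §4.2.1 Cor. 4.2.4] [cite: Milne1986JacobianVarieties, §6 Prop. 6.4 and Remark 6.5] -/
theorem weilPairingLevel_pushforward_aut_eq (hX : IsSmoothProjective 1 X) (𝒥 : Jacobian X) (hdim : 1 ≤ 𝒥.J.dim) (e : X ≅ X)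
    {Θ : CartierDivisor 𝒥.J.X.left} (h1 : 𝒥.IsRiemannThetaDivisor Θ) (h2 : 𝒥.J.IsPrincipalPolarizationDivisor Θ)
    (N : ℕ) [IsDominant (AbelianVariety.Hom.toSchemeHom ((N : ℤ) • 𝟙 𝒥.J))] (P Q : 𝒥.J.torsionPoints ℂ N) :
    𝒥.J.weilPairingLevel Θ
        ⟨AlgPoints.map (𝒥.pushforward 𝒥 e.hom).hom.hom.hom P.1,
          AbelianVariety.map_mem_torsionPoints (𝒥.pushforward 𝒥 e.hom) P.2⟩
        ⟨AlgPoints.map (𝒥.pushforward 𝒥 e.hom).hom.hom.hom Q.1,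
          AbelianVariety.map_mem_torsionPoints (𝒥.pushforward 𝒥 e.hom) Q.2⟩ =
      𝒥.J.weilPairingLevel Θ P Q :=
  weilPairingLevel_pushforward_aut_eq_of_thetaUniq 𝒥 e h1 h2 N
    (fun _ _ g1 g2 g3 g4 P' Q' => weilPairingLevel_eq_of_isRiemannThetaDivisor' hX 𝒥 hdim g1 g2 g3 g4 N P' Q') P Q

/-- **Adjoint form, fact-free: `ē_N^{Θ_X}(Nm_{e⁻¹} P, Q) = ē_N^{Θ_Y}(P, Nm_e Q)`** for `e : X ≅ Y` — `Nm_{e⁻¹} = Nm_e⁻¹` is the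
`ē_N`-adjoint of `Nm_e` (the named fact (F-P2) at `Δ = 1`, now a theorem).
[cite: Lange2023AbelianVarietiesComplex, §4.5.2 eq. (4.9)] [cite: MumfordAV1970, §20 (property (3) of e_n, p. 186)] -/
theorem weilPairingLevel_pushforward_inv_eq' (hX : IsSmoothProjective 1 X)
    (𝒥X : Jacobian X) (𝒥Y : Jacobian Y) (hdim : 1 ≤ 𝒥Y.J.dim) (e : X ≅ Y)
    {ΘX : CartierDivisor 𝒥X.J.X.left} {ΘY : CartierDivisor 𝒥Y.J.X.left}
    (h1 : 𝒥X.IsRiemannThetaDivisor ΘX) (h2 : 𝒥X.J.IsPrincipalPolarizationDivisor ΘX)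
    (h3 : 𝒥Y.IsRiemannThetaDivisor ΘY) (h4 : 𝒥Y.J.IsPrincipalPolarizationDivisor ΘY)
    (N : ℕ) [IsDominant (AbelianVariety.Hom.toSchemeHom ((N : ℤ) • 𝟙 𝒥X.J))]
    [IsDominant (AbelianVariety.Hom.toSchemeHom ((N : ℤ) • 𝟙 𝒥Y.J))]
    (P : 𝒥Y.J.torsionPoints ℂ N) (Q : 𝒥X.J.torsionPoints ℂ N) :
    𝒥X.J.weilPairingLevel ΘX
        ⟨AlgPoints.map (𝒥Y.pushforward 𝒥X e.inv).hom.hom.hom P.1,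
          AbelianVariety.map_mem_torsionPoints (𝒥Y.pushforward 𝒥X e.inv) P.2⟩ Q =
      𝒥Y.J.weilPairingLevel ΘY P
        ⟨AlgPoints.map (𝒥X.pushforward 𝒥Y e.hom).hom.hom.hom Q.1,
          AbelianVariety.map_mem_torsionPoints (𝒥X.pushforward 𝒥Y e.hom) Q.2⟩ := by
  -- apply §1 to the pair `(Nm_{e⁻¹} P, Q)` and use `Nm_e Nm_{e⁻¹} P = P`
  have h := weilPairingLevel_pushforward_iso_eq' hX 𝒥X 𝒥Y hdim e h1 h2 h3 h4 N
    ⟨AlgPoints.map (𝒥Y.pushforward 𝒥X e.inv).hom.hom.hom P.1,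
      AbelianVariety.map_mem_torsionPoints (𝒥Y.pushforward 𝒥X e.inv) P.2⟩ Q
  have hP : (⟨AlgPoints.map (𝒥X.pushforward 𝒥Y e.hom).hom.hom.hom
        (AlgPoints.map (𝒥Y.pushforward 𝒥X e.inv).hom.hom.hom P.1),
      AbelianVariety.map_mem_torsionPoints (𝒥X.pushforward 𝒥Y e.hom)
        (AbelianVariety.map_mem_torsionPoints (𝒥Y.pushforward 𝒥X e.inv) P.2)⟩ : 𝒥Y.J.torsionPoints ℂ N) = P := by
    apply Subtype.ext
    change AlgPoints.map (𝒥X.pushforward 𝒥Y e.hom).hom.hom.hom (AlgPoints.map (𝒥Y.pushforward 𝒥X e.inv).hom.hom.hom P.1) = P.1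
    rw [← AbelianVariety.map_hom_comp_apply, ← pushforward_comp, e.inv_hom_id, pushforward_id, AlgPoints.map_apply]
    exact Category.comp_id _
  rw [hP] at h
  exact h.symm

/-- **Two Jacobian structures of one curve, fact-free**: `ē_N^{Θ₂}(u P, u Q) = ē_N^{Θ₁}(P, Q)` with `u = uniqueUpToIso 𝒥₁ 𝒥₂ = Nm_{𝟙}`
([Milne1986JacobianVarieties] Rem. 6.5) and principal Riemann theta divisors `Θ₁`, `Θ₂`.
[cite: Milne1986JacobianVarieties, §6 Prop. 6.4 and Remark 6.5] [cite: Lange2023AbelianVarietiesComplex, §4.1.2 Prop. 4.1.2 and §4.2.1 Cor. 4.2.4] -/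
theorem weilPairingLevel_uniqueUpToIso_eq' (hX : IsSmoothProjective 1 X) (𝒥₁ 𝒥₂ : Jacobian X) (hdim : 1 ≤ 𝒥₂.J.dim)
    {Θ₁ : CartierDivisor 𝒥₁.J.X.left} {Θ₂ : CartierDivisor 𝒥₂.J.X.left}
    (h1 : 𝒥₁.IsRiemannThetaDivisor Θ₁) (h2 : 𝒥₁.J.IsPrincipalPolarizationDivisor Θ₁)
    (h3 : 𝒥₂.IsRiemannThetaDivisor Θ₂) (h4 : 𝒥₂.J.IsPrincipalPolarizationDivisor Θ₂)
    (N : ℕ) [IsDominant (AbelianVariety.Hom.toSchemeHom ((N : ℤ) • 𝟙 𝒥₁.J))]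
    [IsDominant (AbelianVariety.Hom.toSchemeHom ((N : ℤ) • 𝟙 𝒥₂.J))] (P Q : 𝒥₁.J.torsionPoints ℂ N) :
    𝒥₂.J.weilPairingLevel Θ₂
        ⟨AlgPoints.map (uniqueUpToIso 𝒥₁ 𝒥₂).hom.hom.hom.hom P.1,
          AbelianVariety.map_mem_torsionPoints (uniqueUpToIso 𝒥₁ 𝒥₂).hom P.2⟩
        ⟨AlgPoints.map (uniqueUpToIso 𝒥₁ 𝒥₂).hom.hom.hom.hom Q.1,
          AbelianVariety.map_mem_torsionPoints (uniqueUpToIso 𝒥₁ 𝒥₂).hom Q.2⟩ =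
      𝒥₁.J.weilPairingLevel Θ₁ P Q := by
  have h := weilPairingLevel_pushforward_iso_eq' hX 𝒥₁ 𝒥₂ hdim (Iso.refl X) h1 h2 h3 h4 N P Q
  have hP : ∀ R : 𝒥₁.J.torsionPoints ℂ N,
      (⟨AlgPoints.map (𝒥₁.pushforward 𝒥₂ (Iso.refl X).hom).hom.hom.hom R.1,
        AbelianVariety.map_mem_torsionPoints (𝒥₁.pushforward 𝒥₂ (Iso.refl X).hom) R.2⟩ : 𝒥₂.J.torsionPoints ℂ N) =
        ⟨AlgPoints.map (uniqueUpToIso 𝒥₁ 𝒥₂).hom.hom.hom.hom R.1,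
          AbelianVariety.map_mem_torsionPoints (uniqueUpToIso 𝒥₁ 𝒥₂).hom R.2⟩ := by
    intro R
    apply Subtype.ext
    change AlgPoints.map (𝒥₁.pushforward 𝒥₂ (𝟙 X)).hom.hom.hom R.1 = _
    rw [pushforward_id_eq_uniqueUpToIso_hom]
  rw [hP P, hP Q] at h
  exact h

end Jacobian

end Literature.AlgebraicGeometry.Motives

end
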